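import Mathlib.Analysis.SpecialFunctions.Log.Base
import Literature.Computability.AlgebraicComplexity.MatrixMultiplicationExponent
import Literature.Computability.QuantumComplexity.StabilizerRank
import Literature.Computability.QuantumComplexity.StabilizerSimulationProofs
import HarnessLib

/-!
# Stabilizer tensor rank `χ₃(⟨2^k, 2^k, 2^k⟩)` and the exponent `ω_stab`

Topic `Literature/Computability/AlgebraicComplexity`. Definition request `defn-stabTensorRank`
(route MatrixMultiplication/StabilizerTensorRank, idea card "stabilizer-bilinear-complexity";
items `stmt-MatrixMultiplication-3827 … 3835` inline the predicate below verbatim).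

Read a leg `w : Fin (2^k) × Fin (2^k) → ℂ` of a rank-one term of a decomposition of the matrix
multiplication tensor `⟨2^k, 2^k, 2^k⟩` (`matMulTensor ℂ (2^k) (2^k) (2^k)`, Bläser 2013 §5) as a
`2k`-qubit vector — row bits followed by column bits, `Fin (k + k) → Bool` (`legBits`). A
decomposition `⟨2^k, 2^k, 2^k⟩ = ∑_{i<r} cᵢ · wᵢ ⊗ uᵢ ⊗ vᵢ` over `ℂ` is a STABILIZER SCHEME with `r`
terms if all `3r` legs, so read, are stabilizer states (`stabilizerStates (k + k)`, the Clifford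
orbit of `|0^{2k}⟩`, Aaronson–Gottesman 2004; the vocabulary of stabilizer RANK,
Bravyi–Smith–Smolin / Bravyi–Gosset 2016, transported from vectors to the three legs of a bilinear
algorithm). `stabTensorRank k = χ₃(⟨2^k⟩)` is the least such `r` and
`omegaStab = ω_stab = inf_{k ≥ 1} log₂ χ₃(⟨2^k⟩) / k`.

* `legBits k f` — the `2k`-qubit reading of a leg (VERBATIM the reindexing lambda of the route
  items: `x ↦ f (finFunctionFinEquiv (finTwoEquiv.symm ∘ x ∘ Fin.castAdd k),
  finFunctionFinEquiv (finTwoEquiv.symm ∘ x ∘ Fin.natAdd k))`).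
* `HasStabilizerScheme k r` — `⟨2^k, 2^k, 2^k⟩` has a stabilizer scheme with `r` terms (VERBATIM the
  inline block of the route items, so that they restate as one-liners:
  `hasStabilizerScheme_iff` is `Iff.rfl` against the inline text).
* `stabTensorRank k : ℕ` — `sInf {r | HasStabilizerScheme k r}`; `omegaStab : ℝ` —
  `⨅ k, log₂ (stabTensorRank (k+1)) / (k+1)` (the infimum over `k ≥ 1`, written with an index shift
  so that no empty inner infimum occurs).
* API, all proved: `hasStabilizerScheme_iff`, `stabTensorRank_le_of_hasStabilizerScheme`,
  `omegaStab_le` (each `log₂ χ₃(⟨2^k⟩)/k`, `k ≥ 1`, bounds `ω_stab`), `bddBelow_range_omegaStab`,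
  `omegaStab_nonneg`; `bitSplitEquiv k : QReg (k + k) ≃ Fin (2^k) × Fin (2^k)` (the bijection
  behind `legBits`), `legBits_single` (a matrix unit reads as a computational basis state), the
  standard algorithm `⟨n,n,n⟩ = ∑ e_{κν} ⊗ e_{κμ} ⊗ e_{μν}` (Bläser 2013, §5) as a stabilizer scheme
  (`hasStabilizerScheme_standard`, using the tree's `basisState_mem_stabilizerStates`), hence
  `stabTensorRank_le : χ₃(⟨2^k⟩) ≤ 2^k·2^k·2^k`, the infimum is attained
  (`hasStabilizerScheme_stabTensorRank`) and `tensorRank_le_stabTensorRank : R(⟨2^k⟩) ≤ χ₃(⟨2^k⟩)`.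

## Sources and status of the notion

* The MODEL is the route's (idea card stabilizer-bilinear-complexity, refuter-graded
  new-combination; no published source defines `χ₃`): it restricts the coefficient structure of
  rank decompositions (Bläser 2013, §4: rank = least number of triads; §5, Def. 5.1: `ω`) by the
  stabilizer condition of quantum information (Aaronson–Gottesman 2004, Thm 1: stabilizer states
  = Clifford circuits applied to `|0ⁿ⟩`; Bravyi–Gosset 2016: stabilizer rank `χ` of a vector).
  The docstring tags cite these components; nothing here is claimed to be in print as such.
* `ω ≤ ω_stab ≤ log₂ 7` (Strassen's 21 legs are stabilizer states) and Kronecker-closedness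
  (Fekete) are route items (`StrassenStabilizer`, `StabKronecker`, `StrassenPowerFrame`), not
  vendored here.

## Design choices

* `sInf` over `ℕ`: were no stabilizer scheme to exist the value would be the junk `0`; the set
  is non-empty (`(2^k)³` terms always work, `hasStabilizerScheme_standard`), so `χ₃` is a minimum.
* Imports `…QuantumComplexity.StabilizerSimulationProofs` only for `basisState_mem_stabilizerStates`
  (the requesting route's Theses file imports all of Mathlib, so the weight is immaterial there).
* `omegaStab` is a conditionally complete infimum over `ℝ` of non-negative terms
  (`bddBelow_range_omegaStab`), hence a genuine infimum; the shift `k ↦ k + 1` implements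
  "`k ≥ 1`" (at `k = 0` the quotient `log₂ χ₃ / 0` would be the junk `0`).
* Coefficients `cᵢ ∈ ℂ` are kept separate from the legs (legs are genuine stabilizer states, not
  their multiples), exactly as in the route items.
-/

noncomputable section

open scoped BigOperators

namespace Literature.Computability.AlgebraicComplexity

open Literature.Computability.QuantumComplexity Literature.Computability.Cryptography Finset

/-- The `2k`-qubit reading of a leg `f : Fin (2^k) × Fin (2^k) → ℂ` of a bilinear algorithm for
`2^k × 2^k` matrices: the bit string `x : Fin (k + k) → Bool` (row bits `x ∘ Fin.castAdd k`, then
column bits `x ∘ Fin.natAdd k`, most significant bit conventions those of `finFunctionFinEquiv`)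
is sent to the entry of `f` at the corresponding (row, column) pair. Verbatim the reindexing used
in the items of route MatrixMultiplication/StabilizerTensorRank. The route's device (idea card
stabilizer-bilinear-complexity), assembled from standard components. [folklore] -/
def legBits (k : ℕ) (f : Fin (2 ^ k) × Fin (2 ^ k) → ℂ) : QReg (k + k) → ℂ :=
  fun x : Fin (k + k) → Bool => f (finFunctionFinEquiv (fun j : Fin k => finTwoEquiv.symm
    (x (Fin.castAdd k j))), finFunctionFinEquiv (fun j : Fin k => finTwoEquiv.symm
    (x (Fin.natAdd k j))))

/-- **`⟨2^k, 2^k, 2^k⟩` has a stabilizer scheme with `r` terms**: there are coefficients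
`c : Fin r → ℂ` and legs `w u v : Fin r → (Fin (2^k) × Fin (2^k) → ℂ)` whose `2k`-qubit readings
(`legBits`) are all stabilizer states (`stabilizerStates (k + k)`: Clifford circuits applied to
`|0^{2k}⟩`, Aaronson–Gottesman 2004, Thm 1) and with
`matMulTensor ℂ (2^k) (2^k) (2^k) = ∑ i, c i • triad (w i) (u i) (v i)` (a rank decomposition in
the sense of Bläser 2013, §4, with scalars pulled out of the legs). Verbatim the inline block of the
route items (`hasStabilizerScheme_iff`). The restriction to stabilizer legs is the route's model
(idea card stabilizer-bilinear-complexity), not a notion in print.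
[cite: Blaser2013, §4 (rank decompositions into triads; stabilizer-restricted legs)] -/
def HasStabilizerScheme (k r : ℕ) : Prop :=
  ∃ (c : Fin r → ℂ) (w u v : Fin r → Fin (2 ^ k) × Fin (2 ^ k) → ℂ),
    (∀ i, legBits k (w i) ∈ stabilizerStates (k + k) ∧ legBits k (u i) ∈ stabilizerStates (k + k) ∧
      legBits k (v i) ∈ stabilizerStates (k + k)) ∧
    matMulTensor ℂ (2 ^ k) (2 ^ k) (2 ^ k) = ∑ i, c i • triad (w i) (u i) (v i)

/-- Unfolding of `HasStabilizerScheme` into the literal inline block of the route items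
(definitional, `Iff.rfl`). [folklore] -/
theorem hasStabilizerScheme_iff (k r : ℕ) : HasStabilizerScheme k r ↔
    ∃ (c : Fin r → ℂ) (w u v : Fin r → Fin (2 ^ k) × Fin (2 ^ k) → ℂ), (∀ i,
      (fun x : Fin (k + k) → Bool => w i (finFunctionFinEquiv (fun j : Fin k => finTwoEquiv.symm
        (x (Fin.castAdd k j))), finFunctionFinEquiv (fun j : Fin k => finTwoEquiv.symm
        (x (Fin.natAdd k j))))) ∈ stabilizerStates (k + k) ∧
      (fun x : Fin (k + k) → Bool => u i (finFunctionFinEquiv (fun j : Fin k => finTwoEquiv.symm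
        (x (Fin.castAdd k j))), finFunctionFinEquiv (fun j : Fin k => finTwoEquiv.symm
        (x (Fin.natAdd k j))))) ∈ stabilizerStates (k + k) ∧
      (fun x : Fin (k + k) → Bool => v i (finFunctionFinEquiv (fun j : Fin k => finTwoEquiv.symm
        (x (Fin.castAdd k j))), finFunctionFinEquiv (fun j : Fin k => finTwoEquiv.symm
        (x (Fin.natAdd k j))))) ∈ stabilizerStates (k + k)) ∧
      matMulTensor ℂ (2 ^ k) (2 ^ k) (2 ^ k) = ∑ i, c i • triad (w i) (u i) (v i) :=
  Iff.rfl

/-- **The stabilizer tensor rank** `χ₃(⟨2^k, 2^k, 2^k⟩)`: the least number of terms of a stabilizer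
scheme for `2^k × 2^k` matrix multiplication (`sInf` over `ℕ`; the set is non-empty —
`hasStabilizerScheme_standard` below — so this is a minimum,
`hasStabilizerScheme_stabTensorRank`). The tensor
rank of Bläser 2013, §4 restricted to the route's stabilizer model (idea card
stabilizer-bilinear-complexity; not a notion in print).
[cite: Blaser2013, §4 (rank of a tensor; stabilizer-restricted variant of the route)] -/
def stabTensorRank (k : ℕ) : ℕ :=
  sInf {r : ℕ | HasStabilizerScheme k r}

/-- **The stabilizer exponent** `ω_stab = inf_{k ≥ 1} log₂ χ₃(⟨2^k, 2^k, 2^k⟩) / k`, written with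
the index shift `k ↦ k + 1` (`⨅` over `ℝ`; the terms are non-negative,
`bddBelow_range_omegaStab`, so
this is a genuine infimum, and by Kronecker-closedness of the model — route item `StabKronecker`,
Fekete — also the limit). The analogue for the route's stabilizer model of Bläser 2013, Def. 5.1
(`ω = inf {β | R(⟨n,n,n⟩) = O(n^β)}`, equivalently `inf_k log₂ R(⟨2^k⟩)/k`); the route's target
`OmegaStabTwo` reads `ω_stab = 2`. Not a notion in print.
[cite: Blaser2013, Def. 5.1 (the exponent; stabilizer variant of the route)] -/
def omegaStab : ℝ :=
  ⨅ k : ℕ, Real.logb 2 (stabTensorRank (k + 1)) / ((k + 1 : ℕ) : ℝ)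

/-- A stabilizer scheme with `r` terms bounds `χ₃(⟨2^k⟩)` by `r`. [folklore] -/
theorem stabTensorRank_le_of_hasStabilizerScheme {k r : ℕ} (h : HasStabilizerScheme k r) :
    stabTensorRank k ≤ r :=
  Nat.sInf_le h

/-- The terms `log₂ χ₃(⟨2^{k+1}⟩) / (k+1)` defining `ω_stab` are non-negative (`χ₃ ∈ ℕ`).
[folklore] -/
theorem logb_stabTensorRank_div_nonneg (k : ℕ) :
    0 ≤ Real.logb 2 (stabTensorRank (k + 1)) / ((k + 1 : ℕ) : ℝ) := by
  refine div_nonneg ?_ (Nat.cast_nonneg _)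
  rcases Nat.eq_zero_or_pos (stabTensorRank (k + 1)) with h | h
  · simp [h]
  · exact Real.logb_nonneg one_lt_two (by exact_mod_cast h)

/-- The family defining `ω_stab` is bounded below (by `0`). [folklore] -/
theorem bddBelow_range_omegaStab :
    BddBelow (Set.range fun k : ℕ => Real.logb 2 (stabTensorRank (k + 1)) / ((k + 1 : ℕ) : ℝ)) :=
  ⟨0, by rintro _ ⟨k, rfl⟩; exact logb_stabTensorRank_div_nonneg k⟩

/-- `ω_stab` is non-negative. [folklore] -/
theorem omegaStab_nonneg : 0 ≤ omegaStab :=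
  le_ciInf fun k => logb_stabTensorRank_div_nonneg k

/-- **Each scale bounds the exponent**: `ω_stab ≤ log₂ χ₃(⟨2^k, 2^k, 2^k⟩) / k` for `k ≥ 1`.
[folklore] -/
theorem omegaStab_le {k : ℕ} (hk : 1 ≤ k) :
    omegaStab ≤ Real.logb 2 (stabTensorRank k) / (k : ℝ) := by
  obtain ⟨j, rfl⟩ := Nat.exists_eq_add_of_le' hk
  exact ciInf_le bddBelow_range_omegaStab j

/-- A stabilizer scheme with `r` terms at scale `k ≥ 1` bounds the exponent:
`ω_stab ≤ log₂ r / k` (for `r ≥ 1`; `r = 0` is impossible but not excluded here, and then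
`log₂ 0 = 0` makes the bound read `ω_stab ≤ 0`, so the hypothesis `1 ≤ r` is kept). [folklore] -/
theorem omegaStab_le_of_hasStabilizerScheme {k r : ℕ} (hk : 1 ≤ k) (hr : 1 ≤ r)
    (h : HasStabilizerScheme k r) : omegaStab ≤ Real.logb 2 r / (k : ℝ) := by
  refine (omegaStab_le hk).trans (div_le_div_of_nonneg_right ?_ (Nat.cast_nonneg _))
  rcases Nat.eq_zero_or_pos (stabTensorRank k) with h0 | hpos
  · rw [h0]
    simpa using Real.logb_nonneg one_lt_two (by exact_mod_cast hr : (1 : ℝ) ≤ r)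
  · exact Real.logb_le_logb_of_le one_lt_two (by exact_mod_cast hpos)
      (by exact_mod_cast stabTensorRank_le_of_hasStabilizerScheme h)


/-! ## Bit splitting -/

/-- The bit-splitting bijection `QReg (k + k) ≃ Fin (2^k) × Fin (2^k)`: the first `k` bits are the
binary digits of the row index, the last `k` bits those of the column index (digit conventions of
`finFunctionFinEquiv`); its forward map is literally the reindexing inside `legBits`. [folklore] -/
def bitSplitEquiv (k : ℕ) : QReg (k + k) ≃ Fin (2 ^ k) × Fin (2 ^ k) where
  toFun x := (finFunctionFinEquiv (fun j : Fin k => finTwoEquiv.symm (x (Fin.castAdd k j))),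
    finFunctionFinEquiv (fun j : Fin k => finTwoEquiv.symm (x (Fin.natAdd k j))))
  invFun p := Fin.addCases (fun j => finTwoEquiv (finFunctionFinEquiv.symm p.1 j))
    (fun j => finTwoEquiv (finFunctionFinEquiv.symm p.2 j))
  left_inv x := by
    funext i
    refine Fin.addCases (fun j => ?_) (fun j => ?_) i
    · dsimp only
      rw [Fin.addCases_left]
      simp only [Equiv.symm_apply_apply, Equiv.apply_symm_apply]
    · dsimp only
      rw [Fin.addCases_right]
      simp only [Equiv.symm_apply_apply, Equiv.apply_symm_apply]
  right_inv p := by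
    ext
    · dsimp only
      simp only [Fin.addCases_left, Equiv.symm_apply_apply, Equiv.apply_symm_apply]
    · dsimp only
      simp only [Fin.addCases_right, Equiv.symm_apply_apply, Equiv.apply_symm_apply]

/-- `legBits` is precomposition with `bitSplitEquiv`. [folklore] -/
theorem legBits_eq_comp (k : ℕ) (f : Fin (2 ^ k) × Fin (2 ^ k) → ℂ) :
    legBits k f = f ∘ bitSplitEquiv k :=
  rfl

/-- The `2k`-qubit reading of a matrix unit is a computational basis state. [folklore] -/
theorem legBits_single (k : ℕ) (q : Fin (2 ^ k) × Fin (2 ^ k)) :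
    legBits k (Pi.single q (1 : ℂ)) = basisState ((bitSplitEquiv k).symm q) := by
  funext x
  simp only [legBits_eq_comp, Function.comp_apply, basisState, Pi.single_apply,
    Equiv.apply_eq_iff_eq_symm_apply]

/-- Matrix-unit legs read as stabilizer states (computational basis states are stabilizer
states, `basisState_mem_stabilizerStates`). [cite: AaronsonGottesman2004, §I] -/
theorem legBits_single_mem_stabilizerStates (k : ℕ) (q : Fin (2 ^ k) × Fin (2 ^ k)) :
    legBits k (Pi.single q (1 : ℂ)) ∈ stabilizerStates (k + k) := by
  rw [legBits_single]
  exact basisState_mem_stabilizerStates _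

/-! ## The standard algorithm -/

/-- The standard algorithm as an identity of tensors:
`⟨n,n,n⟩ = ∑_{(κ,μ,ν)} e_{(κ,ν)} ⊗ e_{(κ,μ)} ⊗ e_{(μ,ν)}` (Bläser 2013, §5).
[cite: Blaser2013, §5 (the trivial algorithm)] -/
theorem matMulTensor_eq_sum_standard (K : Type*) [CommSemiring K] (n : ℕ) :
    matMulTensor K n n n = ∑ p : Fin n × Fin n × Fin n,
      triad (Pi.single (p.1, p.2.2) (1 : K)) (Pi.single (p.1, p.2.1) 1)
        (Pi.single (p.2.1, p.2.2) 1) := by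
  classical
  funext a b c
  rw [Finset.sum_apply, Finset.sum_apply, Finset.sum_apply]
  simp only [triad_apply]
  obtain ⟨a₁, a₂⟩ := a
  obtain ⟨b₁, b₂⟩ := b
  obtain ⟨c₁, c₂⟩ := c
  rw [Fintype.sum_eq_single (b₁, b₂, a₂)]
  · by_cases h₁ : a₁ = b₁ <;> by_cases h₂ : b₂ = c₁ <;> by_cases h₃ : a₂ = c₂ <;>
      simp [matMulTensor, Prod.ext_iff, h₁, h₂, h₃, eq_comm]
  · rintro ⟨κ', μ', ν'⟩ hne
    simp only [ne_eq, Prod.mk.injEq, not_and] at hne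
    by_cases h₁ : κ' = b₁
    · subst h₁
      by_cases h₂ : μ' = b₂
      · subst h₂
        have h₃ : ν' ≠ a₂ := hne rfl rfl
        simp [Pi.single_apply, Prod.ext_iff, Ne.symm h₃]
      · simp [Pi.single_apply, Prod.ext_iff, Ne.symm h₂]
    · simp [Pi.single_apply, Prod.ext_iff, Ne.symm h₁]

/-- Reindexing: a stabilizer scheme indexed by any finite type `σ` gives one with `|σ|` terms.
[folklore] -/
theorem hasStabilizerScheme_of_fintype {k : ℕ} {σ : Type*} [Fintype σ] (c : σ → ℂ)
    (w u v : σ → Fin (2 ^ k) × Fin (2 ^ k) → ℂ)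
    (hleg : ∀ s, legBits k (w s) ∈ stabilizerStates (k + k) ∧
      legBits k (u s) ∈ stabilizerStates (k + k) ∧ legBits k (v s) ∈ stabilizerStates (k + k))
    (h : matMulTensor ℂ (2 ^ k) (2 ^ k) (2 ^ k) = ∑ s, c s • triad (w s) (u s) (v s)) :
    HasStabilizerScheme k (Fintype.card σ) := by
  set e := Fintype.equivFin σ
  refine ⟨fun i => c (e.symm i), fun i => w (e.symm i), fun i => u (e.symm i),
    fun i => v (e.symm i), fun i => hleg (e.symm i), h.trans ?_⟩
  exact Fintype.sum_equiv e _ _ fun s => by simp [e]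

/-- **The standard algorithm is a stabilizer scheme**: `χ₃(⟨2^k, 2^k, 2^k⟩)` is witnessed by the
`(2^k)³` matrix-unit triads, whose legs read as computational basis states. [folklore] -/
theorem hasStabilizerScheme_standard (k : ℕ) :
    HasStabilizerScheme k (Fintype.card (Fin (2 ^ k) × Fin (2 ^ k) × Fin (2 ^ k))) := by
  refine hasStabilizerScheme_of_fintype (fun _ => 1)
    (fun p => Pi.single (p.1, p.2.2) 1) (fun p => Pi.single (p.1, p.2.1) 1)
    (fun p => Pi.single (p.2.1, p.2.2) 1) (fun p => ⟨?_, ?_, ?_⟩) ?_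
  · exact legBits_single_mem_stabilizerStates k _
  · exact legBits_single_mem_stabilizerStates k _
  · exact legBits_single_mem_stabilizerStates k _
  · simp only [one_smul]
    exact matMulTensor_eq_sum_standard ℂ (2 ^ k)

/-- `χ₃(⟨2^k, 2^k, 2^k⟩) ≤ 2^k · 2^k · 2^k`. [folklore] -/
theorem stabTensorRank_le (k : ℕ) : stabTensorRank k ≤ 2 ^ k * 2 ^ k * 2 ^ k := by
  have h := stabTensorRank_le_of_hasStabilizerScheme (hasStabilizerScheme_standard k)
  simpa [Fintype.card_prod, Fintype.card_fin, mul_assoc] using h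

/-- The defining set of `stabTensorRank k` is non-empty. [folklore] -/
theorem nonempty_setOf_hasStabilizerScheme (k : ℕ) : {r : ℕ | HasStabilizerScheme k r}.Nonempty :=
  ⟨_, hasStabilizerScheme_standard k⟩

/-- The infimum defining `χ₃` is attained: there is a stabilizer scheme with exactly
`stabTensorRank k` terms. [folklore] -/
theorem hasStabilizerScheme_stabTensorRank (k : ℕ) : HasStabilizerScheme k (stabTensorRank k) :=
  Nat.sInf_mem (nonempty_setOf_hasStabilizerScheme k)

/-- Scalars can be absorbed into the first leg of a triad. [folklore] -/
theorem smul_triad {ι κ μ : Type*} (c : ℂ) (w : ι → ℂ) (u : κ → ℂ) (v : μ → ℂ) :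
    c • triad w u v = triad (c • w) u v := by
  funext a b d
  simp only [Pi.smul_apply, triad_apply, smul_eq_mul]
  ring

/-- **`R(⟨2^k, 2^k, 2^k⟩) ≤ χ₃(⟨2^k, 2^k, 2^k⟩)`**: forgetting the stabilizer constraint (and
absorbing the coefficients into the first legs) turns a stabilizer scheme into a rank
decomposition.
[folklore] -/
theorem tensorRank_le_stabTensorRank (k : ℕ) :
    tensorRank (matMulTensor ℂ (2 ^ k) (2 ^ k) (2 ^ k)) ≤ stabTensorRank k := by
  obtain ⟨c, w, u, v, -, h⟩ := hasStabilizerScheme_stabTensorRank k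
  refine tensorRank_le_of_eq_sum (fun i => c i • w i) u v (h.trans ?_)
  exact Finset.sum_congr rfl fun i _ => smul_triad (c i) (w i) (u i) (v i)

end Literature.Computability.AlgebraicComplexity

end
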